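/-
Copyright (c) 2026 the pub-hodgecm-mathlib formalisation cell (harness21).  Prover seat hodgecm-mathlib-K2Liu-p05 (g9) (chair VALVE 29 (jj) hand on the S6 table, S4 second box
retained), R90-TF section S6 «Ch. 14» (base R90-C14), h413 = `stmt-HodgeConjecture-24833`; card «FIN» of the S6 dealer R90-C14-plan (g2) (R90 bus 2026-09-05T03:10:50Z;
ruling (Q2) 03:09:36Z), part FIN-1 = Flicker's literal `t_1(a,b,c)` (census `K2/K2Liu-p05/g9/FIN-CENSUS.md` c477b047).
-/
import Literature.NumberTheory.Automorphic.UnitaryLatticeTreeEulerRelation            -- ★ the (E1) tree currency: `UnramifiedLocalConjDatum`, `isSelfDualLattice_stdLattice_three`, `forall_isVertexLattice_two_exists_mapGL_N₁_eq`; brings ★ `UnitaryLatticeTreeFixedCosetFlags` (`exists_fixedBy_equiv_fixed_selfDual_rankN`, `exists_fixedBy_conj_equiv_fixed_type`)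
import Literature.NumberTheory.Automorphic.UnitaryLatticeTreeFixedFiniteModelTransport   -- ★ `finite_setOf_latticeGraphIso_eq_of_eigenframe` (over ★ J4a `finite_setOf_latticeGraphIso_diagonal_eq`)
import Literature.NumberTheory.Rogawski1990.FlickerLiteralEigenframes                  -- ★ `literal_one_eq_conj_diagonal`, `flickerFrame_mul_inv`, `gram_flickerFrame`, `diagonal_fin_three`
import Literature.NumberTheory.Automorphic.LocalUnitaryGroupCongr                       -- ★ `antidiagOne_eq_over` (Mok's literal `Φ₃` = the tree's `(StdForm.antidiagonal 3).over`)
import Literature.NumberTheory.Automorphic.ProjectiveDescentLatticeLevelsDischarge        -- ★ `mem_glInt_iff_forall_v_le_one_of_v_det_eq_one` (`GL₃(𝒪)` by entries when `|det| = 1`; §3 only)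
import HarnessLib

/-!
# R90-TF · S6 — «FIN» `R90S6EllipticFixFinite` (part 1: the literal `t_1`): the fixed points of Flicker's elliptic literal `t_1(a,b,c)` on `U₃ ⧸ K₀` and on `U₃ ⧸ K₁` form FINITE sets
# (Kottwitz 1986 §3; Rogawski 1990 §4.9 Lemma 4.9.3; Flicker 1998 §1)

Cell `hodgecm-mathlib`, crux H413 = `stmt-HodgeConjecture-24833`, route of record `HCCMUnconditional`; R90-TF section S6 (base `R90-C14`), dealer R90-C14-plan (g2), hand K2Liu-p05
(g9).  The (E1) RECORD head of typ1's `S6_E1352_elliptic_identity_targets` (v2.3, ruling (Q2)) carries, per literal `γᵢ`, the two finiteness letters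
`(hfin₀ᵢ : (fixedBy (U ⧸ K₀) γᵢ).Finite)` and `(hfin₁ᵢ : (fixedBy (U ⧸ K₁) γᵢ).Finite)` (`U = U(σ, Φ₃)(K)`, `K₀ = GL₃(𝒪) ∩ U` the hyperspecial stabiliser, `K₁ = g₁ GL₃(𝒪) g₁⁻¹ ∩ U`,
`g₁ = diag(1,1,ϖ)`).  THIS FILE discharges both letters for `i = 1`, the literal `t_1(a,b,c) = !![e(a+c), 0, −e(a−c); 0, b, 0; −e(a−c), 0, e(a+c)]` (`2e = 1`, `a, b, c` pairwise distinct
of norm one), in (E1)'s exact currency (`{K : Type} [Field K] [Valued K ℤᵐ⁰] [ValuativeRel K] [Valued.v.Compatible]`, `hd : UnramifiedLocalConjDatum σ ϖ`, `[Fintype 𝓀[K]]`, `h2 : |2| = 1`,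
`h2e`, `hσe`, `ha hb hc`, `hab hbc hac`, `hγ`).  THEOREMS ONLY (no `def`, no `instance`, no notation, no named-fact hypothesis, no `sorry`; default heartbeats); ★-only imports; lane
`--supports stmt-HodgeConjecture-24833 --as helper`.

THE MATHEMATICS.  `t_1(a,b,c) = h · diag(a,b,c) · h⁻¹` for Flicker's frame `h = !![1,0,1; 0,1,0; −1,0,1]` (★ `literal_one_eq_conj_diagonal`), whose columns are a `Φ₃`-ORTHOGONAL eigenframe
with Gram matrix `ᵗσ(h) Φ₃ h = diag(−2, 1, 2)` (★ `gram_flickerFrame`) — UNIMODULAR because `|2| = 1` (this is what distinguishes `t_1` from the `t_ϖ` literals, whose frame has Gram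
`diag(−2ϖ, 1, 2ϖ)`).  With `d := (−1, e, 1) = e • (−2, 1, 2)` one has `diagonal d = (−det diagonal d) • ᵗσ(h) Φ₃ h` (since `−det = e` and `4e² = 1`), which is exactly the model letter of ★
`finite_setOf_latticeGraphIso_eq_of_eigenframe`: the `t_1`-fixed VERTICES of the lattice graph of `(K³, Φ₃)` form a finite set (Kottwitz: a regular element `diag(a,b,c)` of the
compact diagonal torus of `U(diag d)` fixes only the vertices of a bounded interval of lattices, ★ J4a, and the model `M ↦ h⁻¹·M` transports).  The two COSET letters follow because
`U ⧸ K₀` and `U ⧸ K₁` ARE the two vertex types: ★ `exists_fixedBy_equiv_fixed_selfDual_rankN` (`Fix(U ⧸ K₀) ≃` fixed self-dual vertices) and ★ `exists_fixedBy_conj_equiv_fixed_type`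
(`Fix(U ⧸ K₁) ≃` fixed type-`2` vertices), whose transitivity inputs hold for the unramified datum (★ `exists_unitary_mapGL_stdLattice_eq_of_isSelfDualLattice_of_trace`, ★
`forall_isVertexLattice_two_exists_mapGL_N₁_eq`) exactly as in ★ `natCard_fixedBy_add_eq_natCard_fixedBy_inf_add_one_three`.  Bonus: `t_1 ∈ K₀` (unit entries), so the orbit letter
`horb` of the Euler relation is a singleton.
NOT HERE (census (G1)(G2)): the three `t_ϖ` literals (their eigenframe is not unimodular — needs a J4a variant for `diag(−2ϖ,1,2ϖ)`), and the type-(2) classes (★ L6 gives `K₀`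
only).  HONEST LABEL: HC_CM is proved only modulo the 7 printed citations (2 remaining named inputs: hLiu418 = `stmt-HodgeConjecture-24832`, h413 = `stmt-HodgeConjecture-24833`)
until rung 0 closes; finiteness letters are count-neutral plumbing of (E1); nothing here closes a socket; REL ≠ ★ ≠ BUILT.

## References
* [Kottwitz1986] R. E. Kottwitz, *Base change for unit elements of Hecke algebras*, Compositio Math. 60 (1986), §3 (the fixed-point set of a regular elliptic element is bounded).
* [Rogawski1990] J. D. Rogawski, *Automorphic Representations of Unitary Groups in Three Variables*, Ann. of Math. Stud. 123 (1990), §4.9 pp. 54–55, Lemma 4.9.3.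
* [Flicker1998UnitaryFL] Y. Z. Flicker, *Elementary proof of the fundamental lemma for a unitary group*, Canad. J. Math. 50 (1998), §1 p. 76, Prop. 3 p. 78.
-/

set_option autoImplicit false
-- the mandated namespace repeats the single-problem summit's segment (`HodgeConjecture.HodgeConjecture`)
set_option linter.dupNamespace false

open Matrix
open scoped MatrixGroups WithZero Valued
open Literature.NumberTheory.Automorphic Literature.NumberTheory.Automorphic.HermitianLattice Literature.NumberTheory.Automorphic.UnitaryGroup
open Literature.NumberTheory.Automorphic.CartanUnique Literature.NumberTheory.Automorphic.UnitaryLatticeTree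
open Literature.NumberTheory.Rogawski1990.Flicker1998 (literal_one_eq_conj_diagonal flickerFrame_mul_inv flickerFrameInv_mul gram_flickerFrame)

namespace Summit.HodgeConjecture.HodgeConjecture.R90.S6

section TypeOneLiteral

variable {K : Type} [Field K] [Valued K ℤᵐ⁰] [ValuativeRel K] [(Valued.v : Valuation K ℤᵐ⁰).Compatible] {σ : K →+* K} {ϖ : K}

/-! ## §1 The literal `t_1(a,b,c)` fixes finitely many VERTICES of the lattice graph of `(K³, Φ₃)` -/

omit [ValuativeRel K] [(Valued.v : Valuation K ℤᵐ⁰).Compatible] in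
/-- **`Fix(t_1(a,b,c))` is a finite set of vertices**: for `σ` valuation-preserving, `ϖ` a uniformiser, finite residue field, `|2| = 1`, `2e = 1`, `σ e = e` and `a, b, c` pairwise
distinct of norm one, the vertices of the lattice graph of `(K³, Φ₃)` fixed by the unitary element with matrix `t_1(a,b,c)` form a finite set — ★ `finite_setOf_latticeGraphIso_eq_of_eigenframe`
at Flicker's unimodular eigenframe `h` (Gram `diag(−2,1,2)`, model letter `d = (−1, e, 1)`). [cite: Kottwitz1986, §3] [cite: Rogawski1990, §4.9 Lemma 4.9.3] [cite: Flicker1998UnitaryFL, §1 p. 76] -/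
theorem finite_setOf_latticeGraphIso_eq_flickerOne (hvσ : ∀ x, Valued.v (σ x) = Valued.v x) (hϖ : Valued.v ϖ = WithZero.exp (-1 : ℤ)) [Fintype 𝓀[K]]
    (h2 : Valued.v (2 : K) = 1) {e : K} (h2e : 2 * e = 1) (hσe : σ e = e)
    {a b c : K} (ha : σ a * a = 1) (hb : σ b * b = 1) (hc : σ c * c = 1) (hab : a ≠ b) (hbc : b ≠ c) (hac : a ≠ c)
    (γ : ↥(unitaryGroupOfForm σ ((StdForm.antidiagonal 3).over K)))
    (hγ : ((γ : GL (Fin 3) K) : Matrix (Fin 3) (Fin 3) K) = !![e * (a + c), 0, -(e * (a - c)); 0, b, 0; -(e * (a - c)), 0, e * (a + c)]) :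
    {v : {M : Submodule 𝒪[K] (Fin 3 → K) // IsVertex σ ϖ ((StdForm.antidiagonal 3).over K) M} |
      latticeGraphIso σ ϖ ((StdForm.antidiagonal 3).over K) γ v = v}.Finite := by
  haveI : Finite 𝓀[K] := Finite.of_fintype _
  have h20 : (2 : K) ≠ 0 := fun h0 => by rw [h0, map_zero] at h2; exact zero_ne_one h2
  have hve : Valued.v e = 1 := by
    have h1 : Valued.v (2 * e) = 1 := by rw [h2e, map_one]
    rwa [map_mul, h2, one_mul] at h1
  -- Flicker's frame `h` as an element of `GL₃(K)`, with its inverse `h′` (★ `flickerFrame_mul_inv` ∕ `flickerFrameInv_mul`)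
  let A : GL (Fin 3) K :=
    ⟨!![(1 : K), 0, 1; 0, 1, 0; -1, 0, 1], !![e, 0, -e; 0, 1, 0; e, 0, e], flickerFrame_mul_inv h2e, flickerFrameInv_mul h2e⟩
  have hA : (A : Matrix (Fin 3) (Fin 3) K) = !![(1 : K), 0, 1; 0, 1, 0; -1, 0, 1] := rfl
  have hAinv : ((A⁻¹ : GL (Fin 3) K) : Matrix (Fin 3) (Fin 3) K) = !![e, 0, -e; 0, 1, 0; e, 0, e] := rfl
  -- the literal in the eigenframe: `t_1 = h · diag(a,b,c) · h′`
  have hγA : ((γ : GL (Fin 3) K) : Matrix (Fin 3) (Fin 3) K) =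
      (A : Matrix (Fin 3) (Fin 3) K) * Matrix.diagonal ![a, b, c] * ((A⁻¹ : GL (Fin 3) K) : Matrix (Fin 3) (Fin 3) K) := by
    rw [hγ, hA, hAinv, Literature.NumberTheory.Rogawski1990.Flicker1998.diagonal_fin_three, literal_one_eq_conj_diagonal]
  -- the model letter: `diagonal d = (−det diagonal d) • ᵗσ(h) Φ₃ h` with `d = (−1, e, 1)`
  have hgram : formCongr σ A ((StdForm.antidiagonal 3).over K) = !![(-2 : K), 0, 0; 0, 1, 0; 0, 0, 2] := by
    show ((A : Matrix (Fin 3) (Fin 3) K).map σ)ᵀ * (StdForm.antidiagonal 3).over K * (A : Matrix (Fin 3) (Fin 3) K) = _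
    rw [hA, ← antidiagOne_eq_over K 3]
    exact gram_flickerFrame σ
  have hdet_d : (Matrix.diagonal ![(-1 : K), e, 1]).det = -e := by
    rw [Matrix.det_diagonal, Fin.prod_univ_three]
    simp
  have hdA : Matrix.diagonal ![(-1 : K), e, 1] = (-(Matrix.diagonal ![(-1 : K), e, 1]).det) • formCongr σ A ((StdForm.antidiagonal 3).over K) := by
    rw [hdet_d, neg_neg, hgram, Literature.NumberTheory.Rogawski1990.Flicker1998.diagonal_fin_three]
    ext i j
    fin_cases i <;> fin_cases j <;> simp [Matrix.smul_apply, smul_eq_mul] <;> first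
      | linear_combination h2e
      | linear_combination (-1 : K) * h2e
  -- the data of ★ `finite_setOf_latticeGraphIso_eq_of_eigenframe`
  have hd : ∀ i, Valued.v ((![(-1 : K), e, 1]) i) = 1 := by
    intro i; fin_cases i
    · simp
    · exact hve
    · simp
  have hdσ : ∀ i, σ ((![(-1 : K), e, 1]) i) = (![(-1 : K), e, 1]) i := by
    intro i; fin_cases i
    · simp
    · exact hσe
    · simp
  have hsσ : ∀ i, (![a, b, c] : Fin 3 → K) i * σ ((![a, b, c] : Fin 3 → K) i) = 1 := by
    intro i; fin_cases i
    · simpa [mul_comm] using ha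
    · simpa [mul_comm] using hb
    · simpa [mul_comm] using hc
  have hsv : ∀ i, Valued.v ((![a, b, c] : Fin 3 → K) i) = 1 := fun i => v_eq_one_of_mul_map_eq_one hvσ (hsσ i)
  have hreg : ∀ i j : Fin 3, i ≠ j → (![a, b, c] : Fin 3 → K) i ≠ (![a, b, c] : Fin 3 → K) j := by
    intro i j hij
    fin_cases i <;> fin_cases j <;> simp at hij ⊢
    all_goals first | exact hab | exact hab.symm | exact hbc | exact hbc.symm | exact hac | exact hac.symm
  exact finite_setOf_latticeGraphIso_eq_of_eigenframe hvσ hϖ (![(-1 : K), e, 1]) hd hdσ A hdA (![a, b, c]) hsv hsσ hγA hreg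

/-! ## §2 The two COSET letters of (E1) for `t_1(a,b,c)`: `Fix(U ⧸ K₀)` and `Fix(U ⧸ K₁)` are finite -/

/-- **`hfin₀₁` — `Fix_{t_1}(U ⧸ K₀)` IS FINITE** (`K₀ = GL₃(𝒪) ∩ U`, the stabiliser of the hyperspecial root `L₀ = 𝒪³`): `Fix(U ⧸ K₀)` is in bijection with the `t_1`-fixed SELF-DUAL
vertices (★ `exists_fixedBy_equiv_fixed_selfDual_rankN`; the root is self-dual and `U` is transitive on self-dual lattices for the unramified datum), a subset of the finite set of §1.
[cite: Kottwitz1986, §3] [cite: Rogawski1990, §4.9 Lemma 4.9.3] -/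
theorem finite_fixedBy_quotient_glInt_flickerOne (hd : UnramifiedLocalConjDatum σ ϖ) [Fintype 𝓀[K]]
    (h2 : Valued.v (2 : K) = 1) {e : K} (h2e : 2 * e = 1) (hσe : σ e = e)
    {a b c : K} (ha : σ a * a = 1) (hb : σ b * b = 1) (hc : σ c * c = 1) (hab : a ≠ b) (hbc : b ≠ c) (hac : a ≠ c)
    (γ : ↥(unitaryGroupOfForm σ ((StdForm.antidiagonal 3).over K)))
    (hγ : ((γ : GL (Fin 3) K) : Matrix (Fin 3) (Fin 3) K) = !![e * (a + c), 0, -(e * (a - c)); 0, b, 0; -(e * (a - c)), 0, e * (a + c)]) :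
    (MulAction.fixedBy (↥(unitaryGroupOfForm σ ((StdForm.antidiagonal 3).over K)) ⧸
      (glInt 3 K).subgroupOf (unitaryGroupOfForm σ ((StdForm.antidiagonal 3).over K))) γ).Finite := by
  have hfinV := finite_setOf_latticeGraphIso_eq_flickerOne hd.vσ hd.vϖ h2 h2e hσe ha hb hc hab hbc hac γ hγ
  have hroot : IsSelfDualLattice σ ϖ ((StdForm.antidiagonal 3).over K) (stdLattice K 3) := isSelfDualLattice_stdLattice_three hd
  have hA : ∀ M : Submodule (Valued.integer K) (Fin 3 → K), IsSelfDualLattice σ ϖ ((StdForm.antidiagonal 3).over K) M →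
      ∃ u : ↥(unitaryGroupOfForm σ ((StdForm.antidiagonal 3).over K)), mapGL (u : GL (Fin 3) K) (stdLattice K 3) = M := fun M hM =>
    exists_unitary_mapGL_stdLattice_eq_of_isSelfDualLattice_of_trace hd.σσ hd.vσ hd.vϖ hd.trace hM
  obtain ⟨eA, -⟩ := exists_fixedBy_equiv_fixed_selfDual_rankN σ ϖ _ hroot hA γ
  haveI : Finite ↥{v : {M : Submodule (Valued.integer K) (Fin 3 → K) // IsVertex σ ϖ ((StdForm.antidiagonal 3).over K) M} |
      latticeGraphIso σ ϖ ((StdForm.antidiagonal 3).over K) γ v = v ∧ IsSelfDualLattice σ ϖ ((StdForm.antidiagonal 3).over K) v.1} :=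
    (hfinV.subset fun v hv => hv.1).to_subtype
  haveI := Finite.of_equiv _ eA.symm
  exact Set.toFinite _

/-- **`hfin₁₁` — `Fix_{t_1}(U ⧸ K₁)` IS FINITE** (`K₁ = g₁ GL₃(𝒪) g₁⁻¹ ∩ U`, `g₁ = diag(1,1,ϖ)`, the stabiliser of the type-`2` vertex `N₁ = g₁·L₀`): `Fix(U ⧸ K₁)` is in bijection
with the `t_1`-fixed TYPE-`2` vertices (★ `exists_fixedBy_conj_equiv_fixed_type`; `U` is transitive on type-`2` lattices for the unramified datum, ★
`forall_isVertexLattice_two_exists_mapGL_N₁_eq`), again a subset of the finite set of §1. [cite: Kottwitz1986, §3] [cite: Rogawski1990, §4.9 Lemma 4.9.3] -/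
theorem finite_fixedBy_quotient_conj_glInt_flickerOne (hd : UnramifiedLocalConjDatum σ ϖ) [Fintype 𝓀[K]]
    (h2 : Valued.v (2 : K) = 1) {e : K} (h2e : 2 * e = 1) (hσe : σ e = e)
    {a b c : K} (ha : σ a * a = 1) (hb : σ b * b = 1) (hc : σ c * c = 1) (hab : a ≠ b) (hbc : b ≠ c) (hac : a ≠ c)
    (g₁ : GL (Fin 3) K) (hg₁ : (g₁ : Matrix (Fin 3) (Fin 3) K) = Matrix.diagonal ![(1 : K), 1, ϖ])
    (γ : ↥(unitaryGroupOfForm σ ((StdForm.antidiagonal 3).over K)))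
    (hγ : ((γ : GL (Fin 3) K) : Matrix (Fin 3) (Fin 3) K) = !![e * (a + c), 0, -(e * (a - c)); 0, b, 0; -(e * (a - c)), 0, e * (a + c)]) :
    (MulAction.fixedBy (↥(unitaryGroupOfForm σ ((StdForm.antidiagonal 3).over K)) ⧸
      ((glInt 3 K).map (MulAut.conj g₁).toMonoidHom).subgroupOf (unitaryGroupOfForm σ ((StdForm.antidiagonal 3).over K))) γ).Finite := by
  have hfinV := finite_setOf_latticeGraphIso_eq_flickerOne hd.vσ hd.vϖ h2 h2e hσe ha hb hc hab hbc hac γ hγ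
  have hϖ0 : ϖ ≠ 0 := uniformizer_ne_zero hd.vϖ
  have hϖ1 : Valued.v ϖ ≤ 1 := uniformizer_mem_integer hd.vϖ
  -- the base edge `N₁ = g₁·L₀` has type `2`
  have hN₁ : mapGL g₁ (stdLattice K 3) = latt (Matrix.diagonal ![(1 : K), 1, ϖ]) := by rw [← hg₁]; rfl
  have hg₁2 : IsVertexLattice σ ϖ ((StdForm.antidiagonal 3).over K) 2 (mapGL g₁ (stdLattice K 3)) := by
    rw [hN₁]; exact isVertexLattice_two_latt_diagonal_one_one hd.σϖ hϖ1 hϖ0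
  have hB : ∀ M : Submodule (Valued.integer K) (Fin 3 → K), IsVertexLattice σ ϖ ((StdForm.antidiagonal 3).over K) 2 M →
      ∃ u : ↥(unitaryGroupOfForm σ ((StdForm.antidiagonal 3).over K)), mapGL ((u : GL (Fin 3) K) * g₁) (stdLattice K 3) = M := by
    intro M hM
    obtain ⟨u, hu⟩ := forall_isVertexLattice_two_exists_mapGL_N₁_eq hd M hM
    exact ⟨u, by rw [mapGL_mul, hN₁, hu]⟩
  obtain ⟨eB, -⟩ := exists_fixedBy_conj_equiv_fixed_type σ ϖ _ hg₁2 hB γ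
  haveI : Finite ↥{v : {M : Submodule (Valued.integer K) (Fin 3 → K) // IsVertex σ ϖ ((StdForm.antidiagonal 3).over K) M} |
      latticeGraphIso σ ϖ ((StdForm.antidiagonal 3).over K) γ v = v ∧ IsVertexLattice σ ϖ ((StdForm.antidiagonal 3).over K) 2 v.1} :=
    (hfinV.subset fun v hv => hv.1).to_subtype
  haveI := Finite.of_equiv _ eB.symm
  exact Set.toFinite _

/-! ## §3 Bonus: `t_1 ∈ K₀`, so its powers do not move the root coset (the `horb` letter of the Euler relation is a singleton) -/

/-- **`t_1(a,b,c)` is INTEGRAL**: it lies in `K₀ = GL₃(𝒪) ∩ U` (its entries `e(a±c)`, `b`, `0` are integers since `|e| = |a| = |b| = |c| = 1`), hence so do all its powers and the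
orbit `{t_1ⁿ · K₀}` of the root coset is the singleton `{K₀}` — the `horb` letter of ★ `natCard_fixedBy_add_eq_natCard_fixedBy_inf_add_one_three` for this literal.
[cite: Flicker1998UnitaryFL, §1 p. 76] [cite: Rogawski1990, §4.9 p. 54] -/
theorem finite_range_pow_mk_flickerOne (hvσ : ∀ x, Valued.v (σ x) = Valued.v x) (h2 : Valued.v (2 : K) = 1) {e : K} (h2e : 2 * e = 1)
    {a b c : K} (ha : σ a * a = 1) (hb : σ b * b = 1) (hc : σ c * c = 1)
    (γ : ↥(unitaryGroupOfForm σ ((StdForm.antidiagonal 3).over K)))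
    (hγ : ((γ : GL (Fin 3) K) : Matrix (Fin 3) (Fin 3) K) = !![e * (a + c), 0, -(e * (a - c)); 0, b, 0; -(e * (a - c)), 0, e * (a + c)]) :
    (Set.range fun n : ℕ => ((γ ^ n : ↥(unitaryGroupOfForm σ ((StdForm.antidiagonal 3).over K))) :
      ↥(unitaryGroupOfForm σ ((StdForm.antidiagonal 3).over K)) ⧸ (glInt 3 K).subgroupOf (unitaryGroupOfForm σ ((StdForm.antidiagonal 3).over K)))).Finite := by
  have hve : Valued.v e = 1 := by
    have h1 : Valued.v (2 * e) = 1 := by rw [h2e, map_one]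
    rwa [map_mul, h2, one_mul] at h1
  have hva : Valued.v a = 1 := v_eq_one_of_mul_map_eq_one hvσ (by rw [mul_comm]; exact ha)
  have hvb : Valued.v b = 1 := v_eq_one_of_mul_map_eq_one hvσ (by rw [mul_comm]; exact hb)
  have hvc : Valued.v c = 1 := v_eq_one_of_mul_map_eq_one hvσ (by rw [mul_comm]; exact hc)
  -- `t_1 ∈ K₀`: all entries are integral and `|det t_1| = |abc| = 1` (★ `mem_glInt_iff_forall_v_le_one_of_v_det_eq_one`)
  have hint : ∀ i j, Valued.v (((γ : GL (Fin 3) K) : Matrix (Fin 3) (Fin 3) K) i j) ≤ 1 := by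
    have hpm : Valued.v e * Valued.v (a + c) ≤ 1 := by
      rw [hve, one_mul]; exact (Valuation.map_add _ _ _).trans (max_le hva.le hvc.le)
    have hmm : Valued.v e * Valued.v (a - c) ≤ 1 := by
      rw [hve, one_mul]; exact (Valuation.map_sub _ _ _).trans (max_le hva.le hvc.le)
    intro i j
    rw [hγ]
    fin_cases i <;> fin_cases j <;> simp [Valuation.map_neg, hpm, hmm, hvb.le]
  have hdetγ : Valued.v ((γ : GL (Fin 3) K) : Matrix (Fin 3) (Fin 3) K).det = 1 := by
    have hd : ((γ : GL (Fin 3) K) : Matrix (Fin 3) (Fin 3) K).det = a * b * c := by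
      rw [hγ, Matrix.det_fin_three]
      simp
      linear_combination (a * b * c * (2 * e + 1)) * h2e
    rw [hd, map_mul, map_mul, hva, hvb, hvc, one_mul, one_mul]
  have hmem : γ ∈ (glInt 3 K).subgroupOf (unitaryGroupOfForm σ ((StdForm.antidiagonal 3).over K)) := by
    rw [Subgroup.mem_subgroupOf]
    exact (mem_glInt_iff_forall_v_le_one_of_v_det_eq_one _ hdetγ).2 hint
  have hconst : ∀ n : ℕ, ((γ ^ n : ↥(unitaryGroupOfForm σ ((StdForm.antidiagonal 3).over K))) :
      ↥(unitaryGroupOfForm σ ((StdForm.antidiagonal 3).over K)) ⧸ (glInt 3 K).subgroupOf (unitaryGroupOfForm σ ((StdForm.antidiagonal 3).over K))) =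
      ((1 : ↥(unitaryGroupOfForm σ ((StdForm.antidiagonal 3).over K))) : _ ⧸ (glInt 3 K).subgroupOf (unitaryGroupOfForm σ ((StdForm.antidiagonal 3).over K))) := by
    intro n
    rw [QuotientGroup.eq, mul_one]
    exact Subgroup.inv_mem _ (Subgroup.pow_mem _ hmem n)
  refine (Set.finite_singleton ((1 : ↥(unitaryGroupOfForm σ ((StdForm.antidiagonal 3).over K))) :
      _ ⧸ (glInt 3 K).subgroupOf (unitaryGroupOfForm σ ((StdForm.antidiagonal 3).over K)))).subset ?_
  rintro _ ⟨n, rfl⟩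
  exact hconst n

end TypeOneLiteral

end Summit.HodgeConjecture.HodgeConjecture.R90.S6
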